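import Summits.AtomisticToContinuum.BoseEinsteinCondensation.Theses.BECCutLineWeakDisorder
import Summits.AtomisticToContinuum.BoseEinsteinCondensation.Theorems.BECCutLineWeakDisorderWitnessTransferHeig
import Summits.AtomisticToContinuum.BoseEinsteinCondensation.Theorems.BECCutLineWeakDisorderWitnessTransferEnvelope
import Summits.AtomisticToContinuum.BoseEinsteinCondensation.Theorems.BECCutLineWeakDisorderWitnessTransferFormBound
import Summits.AtomisticToContinuum.BoseEinsteinCondensation.Theorems.BECCutLineWeakDisorderWitnessTransferTrialState
import Summits.AtomisticToContinuum.BoseEinsteinCondensation.Theorems.BECCutLineWeakDisorderWitnessTransferRatioMollify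
import Summits.AtomisticToContinuum.BoseEinsteinCondensation.Theorems.BECCutLineWeakDisorderWitnessTransferGlue
import Summits.AtomisticToContinuum.BoseEinsteinCondensation.Theorems.BECCutLineWeakDisorderWitnessTransferVanishOfPointwise
import Summits.AtomisticToContinuum.BoseEinsteinCondensation.Theorems.BECCutLineWeakDisorderWitnessTransferCoreEntry
import Literature.MathematicalPhysics.QuantumManyBody.GroundStateFeynmanKacMarkov
import Literature.MathematicalPhysics.QuantumManyBody.BoseGasHardSet
import Mathlib.Probability.BrownianMotion.Basic
import HarnessLib

/-!
# Route BECCutLineWeakDisorder — crux `WitnessTransfer`: skeleton of line `Sketch` (cycle 2 reshape)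

Crux item stmt-AtomisticToContinuum-14978,
`Summit.AtomisticToContinuum.BoseEinsteinCondensation.Theses.BECCutLineWeakDisorder.WitnessTransfer`
`= (TwoReplicaTransienceBound → LandscapeBound)`.

All first-generation stubs of the line are theorems of the tree — (B) `stub_heig`
(`…WitnessTransferHeig`), (C) `stub_envelope` (`…Envelope`), (E1a) `stub_formBound` (`…FormBound`),
(E1b) `stub_trialState` (`…TrialState`), (F) `stub_ratio_mollify` (`…RatioMollify`), (G)
`stub_landscape_of_parts` (`…Glue`) — except (E2) `stub_vanish` for a GENERAL admissible `v`
(landed sub-cases: hard spheres `…VanishHardSphere`, strongly repulsive hard sets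
`…VanishStrongRepulsion`, empty hard set `…NoHardSet`; landed reduction to POINTWISE vanishing at
hard-set configurations `stub_vanish_of_pointwise`, `…VanishOfPointwise`).

This reshape proves (E2) in general from seven new stubs by a LOCAL-TIME-FREE route: the pair
action `∫₀ᵀ v(|xᵢ − xⱼ + √2 (b(ωᵢ) − b(ωⱼ))_s|) ds` is a.s. infinite from a hard relative position
`y = xᵢ − xⱼ ∈ hardVec v`. Two engines: for `y ≠ 0`, conditioning on the transverse part of the
pair Brownian motion ((S1) independence) reduces to a one-dimensional second-moment /
Paley–Zygmund occupation estimate ((S2)), uniform in small `T`; for `y = 0`, a three-dimensional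
second-moment estimate ((S8)) with the Newtonian potential of a radial charge maximal at the
centre ((S7)). Blumenthal's zero-one law on the `3N` coordinates ((S4)) upgrades the uniform
positive probability to one ((S6), (S9)); `stub_vanish` follows through `stub_vanish_of_pointwise`,
and `WitnessTransfer_of` composes the crux.
-/

noncomputable section

open MeasureTheory ProbabilityTheory Filter Set Metric
open scoped ENNReal NNReal Topology

namespace Summit.AtomisticToContinuum.BoseEinsteinCondensation.Theorems.CutLineWitness

open Literature.MathematicalPhysics.QuantumManyBody.BoseGas
open Literature.Probability.Process

/-! ### (S1) Radial and transverse parts of the pair Brownian motion are independent -/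

/-- **(S1)** For `i ≠ j` and a unit vector `e`, the radial component `⟨e, d_s⟩` of the pair
difference `d_s = (b_s(ω i l) − b_s(ω j l))_l` and its transverse part `d_t − ⟨e, d_t⟩ e` are
independent processes under `wienerPaths N` (jointly Gaussian with vanishing cross covariance).
[folklore] -/
theorem stub_indepFun_pairRadial_pairTransverse {N : ℕ} {i j : Fin N} (hij : i ≠ j) (e : Space)
    (he : ‖e‖ = 1) :
    IndepFun (fun (ω : PathSpace N) (s : ℝ≥0) => ∑ l, e l * (brownian s (ω i l) - brownian s (ω j l)))
      (fun (ω : PathSpace N) (p : Fin 3 × ℝ≥0) =>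
        (brownian p.2 (ω i p.1) - brownian p.2 (ω j p.1)) -
          (∑ l, e l * (brownian p.2 (ω i l) - brownian p.2 (ω j l))) * e p.1)
      (wienerPaths N) := by
  sorry

/-! ### (S2) One-dimensional occupation estimate (second moment, Paley–Zygmund) -/

/-- **(S2)** Let `b` be a pre-Brownian motion with measurable marginals and continuous paths, `T > 0`,
and `k : ℝ → ℝ → [0,∞]` (time, position) jointly measurable with `k_s` supported in `|u| ≤ 2√T`,
`m ≤ ∫ k_s du` for `s ∈ [T/2, T]` and `∫ k_s du ≤ 2m` for `s ∈ [0, T]`, `0 < m < ∞`. Then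
`P(∫₀ᵀ k_s(b_s) ds ≥ (√T/1000) m) ≥ 10⁻⁴` (first moment `≥ e^{-4}√T m/(2√(2π))`, second moment
`≤ (8/√(2π)) √T m ·` first moment, Paley–Zygmund). [folklore] -/
theorem stub_oneDim_occupation_pz {Ω : Type*} [MeasurableSpace Ω] {P : Measure Ω}
    [IsProbabilityMeasure P] {b : ℝ≥0 → Ω → ℝ} (hb : IsPreBrownianReal b P)
    (hbm : ∀ t, Measurable (b t)) (hbc : ∀ ω, Continuous (b · ω)) {T : ℝ} (hT : 0 < T)
    {k : ℝ → ℝ → ℝ≥0∞} (hk : Measurable (Function.uncurry k)) {m : ℝ≥0∞} (hm0 : m ≠ 0)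
    (hmT : m ≠ ⊤) (hsupp : ∀ s u, k s u ≠ 0 → |u| ≤ 2 * Real.sqrt T)
    (hlow : ∀ s ∈ Set.Icc (T / 2) T, m ≤ ∫⁻ u, k s u)
    (hup : ∀ s ∈ Set.Icc 0 T, ∫⁻ u, k s u ≤ 2 * m) :
    ENNReal.ofReal (1 / 10000) ≤
      P {ω | ENNReal.ofReal (Real.sqrt T / 1000) * m ≤ ∫⁻ s in Set.Ioc 0 T, k s (b s.toNNReal ω)} := by
  sorry

/-! ### (S4) Blumenthal's zero-one law for the `3N` Brownian coordinates -/

/-- **(S4)** An event of `PathSpace N` which for every `s > 0` coincides a.s. with an event of the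
past `σ(b_u(ω i k) : u ≤ s, i, k)` has probability `0` or `1` under `wienerPaths N` (weak Markov
property `indepFun_pathsShift_pathsPast`, path continuity and `b₀ = 0`, π–λ).
[cite: RevuzYor1999, Ch. III Thm. (2.15)] -/
theorem stub_wienerPaths_zero_or_one_of_germ {N : ℕ} {E : Set (PathSpace N)}
    (hE : ∀ s : ℝ≥0, 0 < s → ∃ E' : Set (PathSpace N),
      MeasurableSet[MeasurableSpace.comap (fun (ω : PathSpace N) (i : Fin N) (k : Fin 3)
        (u : Set.Iic s) => brownian u (ω i k)) inferInstance] E' ∧ E =ᵐ[wienerPaths N] E') :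
    wienerPaths N E = 0 ∨ wienerPaths N E = 1 := by
  sorry

/-! ### (S7) The Newtonian potential of a radial charge is maximal at the centre -/

/-- **(S7)** For a radial density `g(|w|) ≥ 0` on `ℝ³`, `∫ g(|w|)/|w − x| dw ≤ ∫ g(|w|)/|w| dw` for
a.e. `x` (Newton's shell theorem: the potential of a spherical shell is `mass/max(r, |x|)`).
[folklore] -/
theorem stub_lintegral_radial_mul_inv_norm_sub_le (g : ℝ → ℝ≥0∞) (hg : Measurable g) :
    ∀ᵐ x : Space, ∫⁻ w : Space, g ‖w‖ * ENNReal.ofReal (‖w - x‖⁻¹) ≤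
      ∫⁻ w : Space, g ‖w‖ * ENNReal.ofReal (‖w‖⁻¹) := by
  sorry

/-! ### (S8) Three-dimensional occupation estimate at a coincidence point -/

/-- **(S8)** Let `i ≠ j`, `xᵢ = xⱼ`, `T > 0`, `g : ℝ → [0,∞]` measurable with `g(r) = 0` for
`r > √T`, `m = ∫ g(|w|)/|w| dw ∈ (0, ∞)`, and suppose the potential bound
`∫ g(|w|)/|w − x| dw ≤ K m` for a.e. `x` (`K ≥ 1`). Then the occupation functional of the pair
distance satisfies `P(∫₀ᵀ g(|Bⁱ_s − Bʲ_s|) ds ≥ m/1000) ≥ 1/(1000 K)` (Green function of the pair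
motion `≍ 1/|w|` on `|w| ≤ √T`, second moment, Paley–Zygmund). [folklore] -/
theorem stub_threeDim_occupation_pz {N : ℕ} {X : Config N} {i j : Fin N} (hij : i ≠ j)
    (hX : X i = X j) {T : ℝ} (hT : 0 < T) {g : ℝ → ℝ≥0∞} (hg : Measurable g)
    (hsupp : ∀ r, Real.sqrt T < r → g r = 0) {m : ℝ≥0∞} (hm0 : m ≠ 0) (hmT : m ≠ ⊤)
    (hm : m = ∫⁻ w : Space, g ‖w‖ * ENNReal.ofReal (‖w‖⁻¹)) {K : ℝ} (hK : 1 ≤ K)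
    (hpot : ∀ᵐ x : Space, ∫⁻ w : Space, g ‖w‖ * ENNReal.ofReal (‖w - x‖⁻¹) ≤ ENNReal.ofReal K * m) :
    ENNReal.ofReal (1 / (1000 * K)) ≤
      wienerPaths N {ω | m / 1000 ≤
        ∫⁻ s in Set.Ioc 0 T, g (dist (worldLine X ω s.toNNReal i) (worldLine X ω s.toNNReal j))} := by
  sorry

/-! ### (S6), (S9) The pair action is a.s. infinite from a hard start -/

/-- **(S6)** For a hard point `y = xᵢ − xⱼ ≠ 0` of `v` (`i ≠ j`) and `T > 0`, the pair action
`∫₀ᵀ v(|Bⁱ_s − Bʲ_s|) ds` is a.s. infinite (conditioning on the transverse part (S1), the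
one-dimensional estimate (S2) uniformly in small `T`, Blumenthal (S4)). [folklore] -/
theorem stub_pairAction_ae_top_of_ne_zero {N : ℕ} {v : ℝ → ℝ≥0∞} (hv : Measurable v)
    {X : Config N} {i j : Fin N} (hij : i ≠ j) (hz : X i - X j ∈ hardVec v) (hy : X i - X j ≠ 0)
    {T : ℝ} (hT : 0 < T) :
    ∀ᵐ ω ∂wienerPaths N, ∫⁻ s in Set.Ioc 0 T,
      v (dist (worldLine X ω s.toNNReal i) (worldLine X ω s.toNNReal j)) = ⊤ := by
  -- engine 1: (S1) `stub_indepFun_pairRadial_pairTransverse`, (S2) `stub_oneDim_occupation_pz`,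
  -- (S4) `stub_wienerPaths_zero_or_one_of_germ`
  have _h1 := @stub_indepFun_pairRadial_pairTransverse N i j hij
  have _h2 := @stub_oneDim_occupation_pz (C(ℝ≥0, ℝ))
  have _h4 := @stub_wienerPaths_zero_or_one_of_germ N
  sorry

/-- **(S9)** For coincident particles `xᵢ = xⱼ` (`i ≠ j`) with `0 ∈ hardVec v` and `T > 0`, the
pair action is a.s. infinite ((S7), (S8) with `g = min(v, n)𝟙_{(0,√T]}`, `n → ∞`, Blumenthal
(S4)). [folklore] -/
theorem stub_pairAction_ae_top_of_eq_zero {N : ℕ} {v : ℝ → ℝ≥0∞} (hv : Measurable v)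
    {X : Config N} {i j : Fin N} (hij : i ≠ j) (hz : (0 : Space) ∈ hardVec v) (hy : X i = X j)
    {T : ℝ} (hT : 0 < T) :
    ∀ᵐ ω ∂wienerPaths N, ∫⁻ s in Set.Ioc 0 T,
      v (dist (worldLine X ω s.toNNReal i) (worldLine X ω s.toNNReal j)) = ⊤ := by
  -- engine 2: (S7) `stub_lintegral_radial_mul_inv_norm_sub_le`, (S8) `stub_threeDim_occupation_pz`,
  -- (S4) `stub_wienerPaths_zero_or_one_of_germ`
  have _h7 := @stub_lintegral_radial_mul_inv_norm_sub_le
  have _h8 := @stub_threeDim_occupation_pz N X i j hij hy T hT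
  have _h4 := @stub_wienerPaths_zero_or_one_of_germ N
  sorry

/-! ### Composition: (E2) in general -/

/-- One pair term is below the interaction: `v(|Yᵢ − Yⱼ|) ≤ ∑_{a<b} v(|Y_a − Y_b|)` (`i ≠ j`).
[folklore] -/
theorem le_interaction_of_ne {N : ℕ} (v : ℝ → ℝ≥0∞) (Y : Config N) {i j : Fin N} (hij : i ≠ j) :
    v (dist (Y i) (Y j)) ≤ interaction v Y := by
  classical
  unfold interaction
  rcases lt_or_gt_of_ne hij with h | h
  · calc v (dist (Y i) (Y j))
        ≤ ∑ b ∈ Finset.univ.filter (fun b => i < b), v (dist (Y i) (Y b)) :=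
          Finset.single_le_sum (f := fun b => v (dist (Y i) (Y b))) (fun _ _ => zero_le)
            (Finset.mem_filter.2 ⟨Finset.mem_univ _, h⟩)
      _ ≤ ∑ a, ∑ b ∈ Finset.univ.filter (fun b => a < b), v (dist (Y a) (Y b)) :=
          Finset.single_le_sum (f := fun a => ∑ b ∈ Finset.univ.filter (fun b => a < b),
            v (dist (Y a) (Y b))) (fun _ _ => zero_le) (Finset.mem_univ i)
  · rw [dist_comm]
    calc v (dist (Y j) (Y i))
        ≤ ∑ b ∈ Finset.univ.filter (fun b => j < b), v (dist (Y j) (Y b)) :=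
          Finset.single_le_sum (f := fun b => v (dist (Y j) (Y b))) (fun _ _ => zero_le)
            (Finset.mem_filter.2 ⟨Finset.mem_univ _, h⟩)
      _ ≤ ∑ a, ∑ b ∈ Finset.univ.filter (fun b => a < b), v (dist (Y a) (Y b)) :=
          Finset.single_le_sum (f := fun a => ∑ b ∈ Finset.univ.filter (fun b => a < b),
            v (dist (Y a) (Y b))) (fun _ _ => zero_le) (Finset.mem_univ j)

/-- The pair action dominates from below the full action: if the pair term integrates to `⊤`,
so does `pathAction`. [folklore] -/
theorem pathAction_eq_top_of_pair {N : ℕ} (v : ℝ → ℝ≥0∞) (T : ℝ) (X : Config N)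
    (ω : PathSpace N) {i j : Fin N} (hij : i ≠ j)
    (h : ∫⁻ s in Set.Ioc 0 T,
      v (dist (worldLine X ω s.toNNReal i) (worldLine X ω s.toNNReal j)) = ⊤) :
    pathAction v T X ω = ⊤ := by
  unfold pathAction
  exact eq_top_iff.2 (h ▸ lintegral_mono fun s => le_interaction_of_ne v _ hij)

/-- If the action is a.s. infinite, the partition function vanishes: `(e^{-TH}1)(X) = 0`.
[folklore] -/
theorem fkSemigroup_one_eq_zero_of_ae {N : ℕ} (v : ℝ → ℝ≥0∞) (L T : ℝ) (X : Config N)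
    (h : ∀ᵐ ω ∂wienerPaths N, pathAction v T X ω = ⊤) :
    fkSemigroup v L T (fun _ => (1 : ℝ≥0∞)) X = 0 := by
  have h0 : wienerPaths N {ω | pathAction v T X ω ≠ ⊤} = 0 := by
    rw [measure_eq_zero_iff_ae_notMem]
    filter_upwards [h] with ω hω
    simpa using hω
  refine le_antisymm ((fkSemigroup_one_le_measure v L T X
    (E := {ω | pathAction v T X ω ≠ ⊤}) fun ω hω => ?_).trans h0.le) bot_le
  simp only [mem_setOf_eq, not_not] at hω
  unfold fkWeight
  by_cases hs : ω ∈ survives L T X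
  · rw [indicator_of_mem hs, hω]
    simp [expNeg]
  · rw [indicator_of_notMem hs]

/-- **(E2) `e^{-TH}1 → 0` uniformly near the hard-set configurations (general `v`).** For an admissible `v`, `T > 0`, `η > 0` there is `κ > 0` with
`(e^{-TH_N}1)(X) ≤ η` whenever some `xᵢ − xⱼ` (`i ≠ j`) is within `κ` of `hardVec v`:
the pointwise vanishing at hard-set configurations ((S6), (S9)) fed into
`stub_vanish_of_pointwise`. [folklore] -/
theorem stub_vanish {N : ℕ} {v : ℝ → ℝ≥0∞} (hv : IsRepulsiveFiniteRange v) (L : ℝ) {T : ℝ}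
    (hT : 0 < T) {η : ℝ} (hη : 0 < η) :
    ∃ κ : ℝ, 0 < κ ∧ ∀ X : Config N,
      (∃ i j : Fin N, i ≠ j ∧ ∃ z ∈ hardVec v, dist (X i - X j) z < κ) →
        fkSemigroup v L T (fun _ => (1 : ℝ≥0∞)) X ≤ ENNReal.ofReal η := by
  refine stub_vanish_of_pointwise hv.1 L hT (fun X ⟨i, j, hij, hz⟩ => ?_) hη
  refine fkSemigroup_one_eq_zero_of_ae v L T X ?_
  by_cases hy : X i - X j = 0
  · have h0 : (0 : Space) ∈ hardVec v := hy ▸ hz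
    filter_upwards [stub_pairAction_ae_top_of_eq_zero hv.1 hij h0 (sub_eq_zero.1 hy) hT]
      with ω hω using pathAction_eq_top_of_pair v T X ω hij hω
  · filter_upwards [stub_pairAction_ae_top_of_ne_zero hv.1 hij hz hy hT]
      with ω hω using pathAction_eq_top_of_pair v T X ω hij hω

end Summit.AtomisticToContinuum.BoseEinsteinCondensation.Theorems.CutLineWitness

/-! ### The composition -/

namespace Summit.AtomisticToContinuum.BoseEinsteinCondensation.Theorems

open Literature.MathematicalPhysics.QuantumManyBody.BoseGas CutLineWitness

/-- **The crux from the stubs**: (B), (C), (E1a), (E1b), (F), (E2) (now from (S1)–(S9)) and the glue (G) give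
`WitnessTransfer = (TwoReplicaTransienceBound → LandscapeBound)`. [folklore] -/
theorem WitnessTransfer_of :
    Summit.AtomisticToContinuum.BoseEinsteinCondensation.Theses.BECCutLineWeakDisorder.WitnessTransfer := by
  intro hTR v hv
  exact stub_landscape_of_parts (fun hv L _ hT h0 _ ht => stub_heig hv L hT h0 ht)
    (fun hv _ hL hN hE => stub_envelope hv hL hN hE)
    (fun hv _ hL _ hΨm _ hM hnn h0 hnorm _ heig => stub_formBound hv hL hΨm hM hnn h0 hnorm heig)
    (fun hv _ hL _ hfm _ hM hnn hsymm hpos _ hSm hSbox _ hr₀ hmargin hSV _ hK hev _ hε =>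
      stub_trialState hv hL hfm hM hnn hsymm hpos hSm hSbox hr₀ hmargin hSV hK hev hε)
    (fun hfm _ hM hnn _ hr₀ h0 _ hε => stub_ratio_mollify hfm hM hnn hr₀ h0 hε)
    (fun hv L _ hT _ hη => stub_vanish hv L hT hη)
    v hv (hTR v hv)

end Summit.AtomisticToContinuum.BoseEinsteinCondensation.Theorems

end
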